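import Literature.MathematicalPhysics.QuantumManyBody.OneCoordinateMarginal
import HarnessLib

/-!
# One-coordinate marginals: calculus along the distinguished coordinate

For a `C¹` compactly supported `N`-body wave function `ψ` and a coordinate `p = (i,a)` this file
proves the elementary calculus of the marginal mass `m(t) = ∫_{x_p = t} |ψ|²` and the slice
current `j(t) = ∫_{x_p=t} Re(conj ψ ∂_p ψ)` introduced in `OneCoordinateMarginal.lean`:

* `hasDerivAt_marginalMassReal` : `m' = 2 j` (differentiation under the integral sign);
* `sliceCurrent_sq_le` : the Cauchy–Schwarz bound `j(t)² ≤ m(t) · e_t(t)` with the normal slice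
  kinetic energy `e_t(t) = ∫_{x_p=t} |∂_p ψ|²`;
* support bookkeeping on slices (`exists_radius_tsupport`, `eq_zero_of_abs_gt`, …).

All statements are folklore (one-variable calculus for parameter integrals of compactly supported
`C¹` functions). [folklore]
-/

noncomputable section

namespace Literature.MathematicalPhysics.QuantumManyBody.BoseGas

open _root_.MeasureTheory Filter Set Function
open scoped ENNReal NNReal Topology

variable {N : ℕ}
section Calculus

variable {ψ : Config N → ℂ}

/-- Along the distinguished coordinate the wave function is a `C¹` function of `t` with derivative
`∂_p ψ`. [folklore] -/
theorem hasDerivAt_comp_sliceMap (hψ : ContDiff ℝ 1 ψ) (p : Fin N × Fin 3)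
    (y : SliceIdx N p → ℝ) (t : ℝ) :
    HasDerivAt (fun t : ℝ => ψ (sliceMap p (t, y)))
      (fderiv ℝ ψ (sliceMap p (t, y)) (unitVec p.1 p.2)) t := by
  have hline : HasDerivAt (fun t : ℝ => sliceMap p (0, y) + t • unitVec p.1 p.2)
      (unitVec p.1 p.2) t := by
    have := ((hasDerivAt_id t).smul_const (unitVec p.1 p.2 : Config N)).const_add (sliceMap p (0, y))
    simpa using this
  have hψd : HasFDerivAt ψ (fderiv ℝ ψ (sliceMap p (t, y))) (sliceMap p (0, y) + t • unitVec p.1 p.2) := by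
    rw [← sliceMap_eq_add_smul]
    exact (hψ.differentiable one_ne_zero _).hasFDerivAt
  have := hψd.comp_hasDerivAt t hline
  have hfun : (fun t : ℝ => ψ (sliceMap p (t, y))) = ψ ∘ fun t : ℝ => sliceMap p (0, y) + t • unitVec p.1 p.2 := by
    funext s; simp [sliceMap_eq_add_smul p s y]
  rw [hfun]
  exact this

/-- Derivative of `t ↦ |ψ|²` along the distinguished coordinate: `2 Re(conj ψ · ∂_p ψ)`. [folklore] -/
theorem hasDerivAt_normSq_comp_sliceMap (hψ : ContDiff ℝ 1 ψ) (p : Fin N × Fin 3)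
    (y : SliceIdx N p → ℝ) (t : ℝ) :
    HasDerivAt (fun t : ℝ => ‖ψ (sliceMap p (t, y))‖ ^ 2)
      (2 * RCLike.re (starRingEnd ℂ (ψ (sliceMap p (t, y))) *
        fderiv ℝ ψ (sliceMap p (t, y)) (unitVec p.1 p.2))) t := by
  have h := (hasDerivAt_comp_sliceMap hψ p y t).norm_sq
  convert h using 1
  rw [Complex.inner, mul_comm]
  simp [RCLike.re_to_complex]
  ring



/-- Coordinates of slice points are coordinates of the configuration: if the configuration lies in
the sup-norm ball of radius `R`, so do all slice coordinates `y q`. [folklore] -/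
theorem abs_slice_coord_le {p : Fin N × Fin 3} {t : ℝ} {y : SliceIdx N p → ℝ} {R : ℝ}
    (h : ‖sliceMap p (t, y)‖ ≤ R) (q : SliceIdx N p) : |y q| ≤ R := by
  have h1 : sliceMap p (t, y) q.1.1 q.1.2 = y q := by
    rw [sliceMap_apply]
    simp [q.2]
  calc |y q| = |sliceMap p (t, y) q.1.1 q.1.2| := by rw [h1]
    _ ≤ ‖sliceMap p (t, y) q.1.1‖ := by
        simpa using PiLp.norm_apply_le (sliceMap p (t, y) q.1.1) q.1.2
    _ ≤ ‖sliceMap p (t, y)‖ := norm_le_pi_norm _ _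
    _ ≤ R := h

/-- The slice box `{y | ∀ q, |y q| ≤ R}` has finite measure. [folklore] -/
theorem volume_sliceBox_lt_top (p : Fin N × Fin 3) (R : ℝ) :
    volume {y : SliceIdx N p → ℝ | ∀ q, |y q| ≤ R} < ⊤ := by
  have : {y : SliceIdx N p → ℝ | ∀ q, |y q| ≤ R} = Set.pi Set.univ fun _ => Set.Icc (-R) R := by
    ext y
    simp only [Set.mem_setOf_eq, Set.mem_pi, Set.mem_univ, Set.mem_Icc, forall_const, abs_le]
  rw [this, volume_pi_pi]
  simp [Real.volume_Icc]

/-- Auxiliary measurability/support fact for one-coordinate slices. [folklore] -/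
theorem measurableSet_sliceBox (p : Fin N × Fin 3) (R : ℝ) :
    MeasurableSet {y : SliceIdx N p → ℝ | ∀ q, |y q| ≤ R} := by
  have : {y : SliceIdx N p → ℝ | ∀ q, |y q| ≤ R} = Set.pi Set.univ fun _ => Set.Icc (-R) R := by
    ext y
    simp only [Set.mem_setOf_eq, Set.mem_pi, Set.mem_univ, Set.mem_Icc, forall_const, abs_le]
  rw [this]
  exact MeasurableSet.univ_pi fun _ => measurableSet_Icc

/-- **Differentiation under the integral sign for the marginal mass.** For a `C¹` compactly
supported wave function, `t ↦ m(t)` is differentiable with `m'(t) = 2 j(t)` (twice the slice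
current). [folklore] -/
theorem hasDerivAt_marginalMassReal {ψ : Config N → ℂ} (hψ : ContDiff ℝ 1 ψ) (hsupp : HasCompactSupport ψ)
    (p : Fin N × Fin 3) (t₀ : ℝ) :
    HasDerivAt (marginalMassReal ψ p) (2 * sliceCurrent ψ p t₀) t₀ := by
  -- uniform bounds
  obtain ⟨C₀, hC₀⟩ := (hψ.continuous.norm).bddAbove_range_of_hasCompactSupport hsupp.norm
  have hdsupp : HasCompactSupport (fderiv ℝ ψ) := hsupp.fderiv (𝕜 := ℝ)
  have hdcont : Continuous (fderiv ℝ ψ) := hψ.continuous_fderiv one_ne_zero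
  obtain ⟨C₁, hC₁⟩ := (hdcont.norm).bddAbove_range_of_hasCompactSupport hdsupp.norm
  -- a radius containing both supports
  obtain ⟨R, hR⟩ : ∃ R : ℝ, ∀ X, X ∈ tsupport ψ ∪ tsupport (fderiv ℝ ψ) → ‖X‖ ≤ R := by
    obtain ⟨R, hR⟩ := (hsupp.union hdsupp).isBounded.subset_closedBall 0
    exact ⟨R, fun X hX => by simpa using hR hX⟩
  set e : Config N := unitVec p.1 p.2 with he
  set box : Set (SliceIdx N p → ℝ) := {y | ∀ q, |y q| ≤ R} with hbox
  have hboxm : MeasurableSet box := measurableSet_sliceBox p R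
  have hboxv : volume box < ⊤ := volume_sliceBox_lt_top p R
  -- the integrand family and its derivative
  set F : ℝ → (SliceIdx N p → ℝ) → ℝ := fun t y => ‖ψ (sliceMap p (t, y))‖ ^ 2 with hF
  set F' : ℝ → (SliceIdx N p → ℝ) → ℝ := fun t y =>
    2 * RCLike.re (starRingEnd ℂ (ψ (sliceMap p (t, y))) * fderiv ℝ ψ (sliceMap p (t, y)) e) with hF'
  have hsm : ∀ t : ℝ, Measurable fun y : SliceIdx N p → ℝ => sliceMap p (t, y) := fun t =>
    (measurePreserving_sliceMap p).measurable.comp (measurable_const.prodMk measurable_id)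
  have hFm : ∀ t, Measurable (F t) := fun t =>
    (hψ.continuous.norm.measurable.comp (hsm t)).pow_const 2
  have hde : Continuous fun X => fderiv ℝ ψ X e := hdcont.clm_apply continuous_const
  have hF'm : ∀ t, Measurable (F' t) := fun t => by
    refine measurable_const.mul (RCLike.measurable_re.comp ?_)
    exact ((Complex.continuous_conj.measurable.comp (hψ.continuous.measurable.comp (hsm t))).mul
      (hde.measurable.comp (hsm t)))
  -- support control: outside the box everything vanishes
  have hzero : ∀ t y, y ∉ box → ψ (sliceMap p (t, y)) = 0 := by
    intro t y hy
    by_contra hne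
    apply hy
    intro q
    refine abs_slice_coord_le (hR _ (Or.inl (subset_tsupport _ hne))) q
  -- pointwise bounds
  have hψb : ∀ X, ‖ψ X‖ ≤ C₀ := fun X => hC₀ (Set.mem_range_self X)
  have hdb : ∀ X, ‖fderiv ℝ ψ X‖ ≤ C₁ := fun X => hC₁ (Set.mem_range_self X)
  have hC₀0 : 0 ≤ C₀ := (norm_nonneg _).trans (hψb 0)
  have hC₁0 : 0 ≤ C₁ := (norm_nonneg _).trans (hdb 0)
  have hF'b : ∀ t y, ‖F' t y‖ ≤ box.indicator (fun _ => 2 * C₀ * (C₁ * ‖e‖)) y := by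
    intro t y
    by_cases hy : y ∈ box
    · rw [Set.indicator_of_mem hy, hF']
      simp only [Real.norm_eq_abs]
      calc |2 * RCLike.re (starRingEnd ℂ (ψ (sliceMap p (t, y))) * fderiv ℝ ψ (sliceMap p (t, y)) e)|
          = 2 * |RCLike.re (starRingEnd ℂ (ψ (sliceMap p (t, y))) * fderiv ℝ ψ (sliceMap p (t, y)) e)| := by
            rw [abs_mul, abs_two]
        _ ≤ 2 * ‖starRingEnd ℂ (ψ (sliceMap p (t, y))) * fderiv ℝ ψ (sliceMap p (t, y)) e‖ := by
            gcongr; exact RCLike.abs_re_le_norm _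
        _ = 2 * (‖ψ (sliceMap p (t, y))‖ * ‖fderiv ℝ ψ (sliceMap p (t, y)) e‖) := by
            rw [norm_mul, Complex.norm_conj]
        _ ≤ 2 * (C₀ * (C₁ * ‖e‖)) := by
            gcongr
            · exact hψb _
            · exact (ContinuousLinearMap.le_opNorm _ _).trans (by gcongr; exact hdb _)
        _ = 2 * C₀ * (C₁ * ‖e‖) := by ring
    · rw [Set.indicator_of_notMem hy, hF']
      simp [hzero t y hy]
  have hFb : ∀ t y, ‖F t y‖ ≤ box.indicator (fun _ => C₀ ^ 2) y := by
    intro t y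
    by_cases hy : y ∈ box
    · rw [Set.indicator_of_mem hy, hF]
      simp only [norm_pow, norm_norm]
      exact pow_le_pow_left₀ (norm_nonneg _) (hψb _) 2
    · rw [Set.indicator_of_notMem hy, hF]
      simp [hzero t y hy]
  -- integrability of the bounds
  have hbound_int : Integrable (box.indicator fun _ : SliceIdx N p → ℝ => 2 * C₀ * (C₁ * ‖e‖)) := by
    rw [integrable_indicator_iff hboxm]
    exact integrableOn_const hboxv.ne
  have hFint : ∀ t, Integrable (F t) := by
    intro t
    have hb : Integrable (box.indicator fun _ : SliceIdx N p → ℝ => C₀ ^ 2) := by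
      rw [integrable_indicator_iff hboxm]
      exact integrableOn_const hboxv.ne
    exact hb.mono' (hFm t).aestronglyMeasurable (Filter.Eventually.of_forall (hFb t))
  -- differentiate under the integral sign
  have key := hasDerivAt_integral_of_dominated_loc_of_deriv_le (μ := volume) (F := F) (F' := F')
    (x₀ := t₀) (s := Set.univ) (bound := box.indicator fun _ => 2 * C₀ * (C₁ * ‖e‖)) Filter.univ_mem
    (Filter.Eventually.of_forall fun t => (hFm t).aestronglyMeasurable) (hFint t₀)
    (hF'm t₀).aestronglyMeasurable
    (Filter.Eventually.of_forall fun y t _ => hF'b t y) hbound_int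
    (Filter.Eventually.of_forall fun y t _ => by
      simpa [hF, hF'] using hasDerivAt_normSq_comp_sliceMap hψ p y t)
  have h2 : ∫ y, F' t₀ y = 2 * sliceCurrent ψ p t₀ := by
    rw [hF', sliceCurrent, ← integral_const_mul]
  rw [← h2]
  exact key.2

end Calculus

section Support

variable {ψ : Config N → ℂ}

/-- A radius bounding the supports of a compactly supported `C¹` function and of its derivative. [folklore] -/
theorem exists_radius_tsupport (hψ : ContDiff ℝ 1 ψ) (hsupp : HasCompactSupport ψ) :
    ∃ R : ℝ, ∀ X, X ∈ tsupport ψ ∪ tsupport (fderiv ℝ ψ) → ‖X‖ ≤ R := by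
  have hdsupp : HasCompactSupport (fderiv ℝ ψ) := hsupp.fderiv (𝕜 := ℝ)
  obtain ⟨R, hR⟩ := (hsupp.union hdsupp).isBounded.subset_closedBall 0
  have _ := hψ
  exact ⟨R, fun X hX => by simpa using hR hX⟩

/-- Outside the slice box of a support radius the wave function vanishes on the slice. [folklore] -/
theorem eq_zero_of_not_mem_sliceBox {R : ℝ} (hR : ∀ X, X ∈ tsupport ψ ∪ tsupport (fderiv ℝ ψ) → ‖X‖ ≤ R)
    (p : Fin N × Fin 3) (t : ℝ) {y : SliceIdx N p → ℝ} (hy : y ∉ {y : SliceIdx N p → ℝ | ∀ q, |y q| ≤ R}) :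
    ψ (sliceMap p (t, y)) = 0 := by
  by_contra hne
  exact hy fun q => abs_slice_coord_le (hR _ (Or.inl (subset_tsupport _ hne))) q

/-- … and so does its derivative. [folklore] -/
theorem fderiv_eq_zero_of_not_mem_sliceBox {R : ℝ}
    (hR : ∀ X, X ∈ tsupport ψ ∪ tsupport (fderiv ℝ ψ) → ‖X‖ ≤ R)
    (p : Fin N × Fin 3) (t : ℝ) {y : SliceIdx N p → ℝ} (hy : y ∉ {y : SliceIdx N p → ℝ | ∀ q, |y q| ≤ R}) :
    fderiv ℝ ψ (sliceMap p (t, y)) = 0 := by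
  by_contra hne
  exact hy fun q => abs_slice_coord_le (hR _ (Or.inr (subset_tsupport _ hne))) q

/-- If the distinguished coordinate is outside the support radius, the whole slice misses the support. [folklore] -/
theorem eq_zero_of_abs_gt {R : ℝ} (hR : ∀ X, X ∈ tsupport ψ ∪ tsupport (fderiv ℝ ψ) → ‖X‖ ≤ R)
    (p : Fin N × Fin 3) {t : ℝ} (ht : R < |t|) (y : SliceIdx N p → ℝ) :
    ψ (sliceMap p (t, y)) = 0 := by
  by_contra hne
  have h1 := hR _ (Or.inl (subset_tsupport _ hne))
  have h2 : |t| ≤ ‖sliceMap p (t, y)‖ := by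
    calc |t| = |sliceMap p (t, y) p.1 p.2| := by rw [sliceMap_apply_same]
      _ ≤ ‖sliceMap p (t, y) p.1‖ := by simpa using PiLp.norm_apply_le (sliceMap p (t, y) p.1) p.2
      _ ≤ ‖sliceMap p (t, y)‖ := norm_le_pi_norm _ _
  linarith

end Support

/-- Elementary Cauchy–Schwarz for real integrals: `(∫ f g)² ≤ (∫ f²)(∫ g²)` for nonnegative
`f, g` (via `2fg ≤ λ f² + g²/λ`). [folklore] -/
theorem integral_mul_sq_le_integral_sq_mul {α : Type*} [MeasurableSpace α] {μ : Measure α}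
    {f g : α → ℝ} (hf : ∀ x, 0 ≤ f x) (hg : ∀ x, 0 ≤ g x)
    (hf2 : Integrable (fun x => f x ^ 2) μ) (hg2 : Integrable (fun x => g x ^ 2) μ)
    (hfg : Integrable (fun x => f x * g x) μ) :
    (∫ x, f x * g x ∂μ) ^ 2 ≤ (∫ x, f x ^ 2 ∂μ) * (∫ x, g x ^ 2 ∂μ) := by
  set A := ∫ x, f x ^ 2 ∂μ with hA
  set B := ∫ x, g x ^ 2 ∂μ with hB
  set J := ∫ x, f x * g x ∂μ with hJ
  have hA0 : 0 ≤ A := integral_nonneg fun x => sq_nonneg _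
  have hB0 : 0 ≤ B := integral_nonneg fun x => sq_nonneg _
  have hJ0 : 0 ≤ J := integral_nonneg fun x => mul_nonneg (hf x) (hg x)
  -- `2 J ≤ λ A + B / λ`
  have key : ∀ l : ℝ, 0 < l → 2 * J ≤ l * A + B / l := by
    intro l hl
    have hpt : ∀ x, 2 * (f x * g x) ≤ l * f x ^ 2 + g x ^ 2 / l := by
      intro x
      have h1 : 0 ≤ (l * f x - g x) ^ 2 / l := div_nonneg (sq_nonneg _) hl.le
      have h2 : (l * f x - g x) ^ 2 / l = l * f x ^ 2 + g x ^ 2 / l - 2 * (f x * g x) := by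
        field_simp; ring
      linarith
    calc 2 * J = ∫ x, 2 * (f x * g x) ∂μ := by rw [hJ, integral_const_mul]
      _ ≤ ∫ x, (l * f x ^ 2 + g x ^ 2 / l) ∂μ :=
          integral_mono (hfg.const_mul 2) ((hf2.const_mul l).add (hg2.div_const l)) hpt
      _ = l * A + B / l := by
          rw [integral_add (hf2.const_mul l) (hg2.div_const l), integral_const_mul, integral_div]
  rcases hA0.eq_or_lt with hA00 | hApos
  · -- `A = 0` forces `J = 0`
    have : J ≤ 0 := by
      by_contra hJpos
      rw [not_le] at hJpos
      have h := key ((B + 1) / J) (by positivity)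
      rw [← hA00, mul_zero, zero_add, div_div_eq_mul_div, mul_comm B J] at h
      have : J * B / (B + 1) < J := by
        rw [div_lt_iff₀ (by positivity)]; nlinarith
      linarith
    have hJ00 : J = 0 := le_antisymm this hJ0
    rw [hJ00]; simpa using mul_nonneg hA0 hB0
  rcases hB0.eq_or_lt with hB00 | hBpos
  · have : J ≤ 0 := by
      by_contra hJpos
      rw [not_le] at hJpos
      have h := key (J / A) (by positivity)
      rw [← hB00, zero_div, add_zero, div_mul_cancel₀ _ hApos.ne'] at h
      linarith
    have hJ00 : J = 0 := le_antisymm this hJ0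
    rw [hJ00]; simpa using mul_nonneg hA0 hB0
  -- optimal `λ = √(B/A)`
  have h := key (Real.sqrt B / Real.sqrt A) (by positivity)
  have hsA : Real.sqrt A ^ 2 = A := Real.sq_sqrt hA0
  have hsB : Real.sqrt B ^ 2 = B := Real.sq_sqrt hB0
  have hsA0 : 0 < Real.sqrt A := Real.sqrt_pos.2 hApos
  have hsB0 : 0 < Real.sqrt B := Real.sqrt_pos.2 hBpos
  have h' : Real.sqrt B / Real.sqrt A * A + B / (Real.sqrt B / Real.sqrt A) = 2 * (Real.sqrt A * Real.sqrt B) := by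
    field_simp
    nlinarith [hsA, hsB]
  rw [h'] at h
  have hJle : J ≤ Real.sqrt A * Real.sqrt B := by linarith
  calc J ^ 2 ≤ (Real.sqrt A * Real.sqrt B) ^ 2 := pow_le_pow_left₀ hJ0 hJle 2
    _ = A * B := by rw [mul_pow, hsA, hsB]

section CauchySchwarz

variable {ψ : Config N → ℂ}

/-- Integrability on the slice from a bound supported in a slice box. [folklore] -/
theorem integrable_of_le_indicator_sliceBox (p : Fin N × Fin 3) (R C : ℝ) {h : (SliceIdx N p → ℝ) → ℝ}
    (hm : Measurable h) (hb : ∀ y, ‖h y‖ ≤ {y : SliceIdx N p → ℝ | ∀ q, |y q| ≤ R}.indicator (fun _ => C) y) :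
    Integrable h := by
  have hB : Integrable ({y : SliceIdx N p → ℝ | ∀ q, |y q| ≤ R}.indicator fun _ : SliceIdx N p → ℝ => C) := by
    rw [integrable_indicator_iff (measurableSet_sliceBox p R)]
    exact integrableOn_const (volume_sliceBox_lt_top p R).ne
  exact hB.mono' hm.aestronglyMeasurable (Filter.Eventually.of_forall hb)

/-- **Cauchy–Schwarz on the slice**: `j(t)² ≤ m(t) · e_t(t)` for a `C¹` compactly supported `ψ`. [folklore] -/
theorem sliceCurrent_sq_le (hψ : ContDiff ℝ 1 ψ) (hsupp : HasCompactSupport ψ)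
    (p : Fin N × Fin 3) (t : ℝ) :
    sliceCurrent ψ p t ^ 2 ≤ marginalMassReal ψ p t * normalSliceEnergyReal ψ p t := by
  obtain ⟨R, hR⟩ := exists_radius_tsupport hψ hsupp
  obtain ⟨C₀, hC₀⟩ := (hψ.continuous.norm).bddAbove_range_of_hasCompactSupport hsupp.norm
  have hdsupp : HasCompactSupport (fderiv ℝ ψ) := hsupp.fderiv (𝕜 := ℝ)
  have hdcont : Continuous (fderiv ℝ ψ) := hψ.continuous_fderiv one_ne_zero
  obtain ⟨C₁, hC₁⟩ := (hdcont.norm).bddAbove_range_of_hasCompactSupport hdsupp.norm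
  have hψb : ∀ X, ‖ψ X‖ ≤ C₀ := fun X => hC₀ (Set.mem_range_self X)
  have hdb : ∀ X, ‖fderiv ℝ ψ X‖ ≤ C₁ := fun X => hC₁ (Set.mem_range_self X)
  set e : Config N := unitVec p.1 p.2 with he
  set box : Set (SliceIdx N p → ℝ) := {y | ∀ q, |y q| ≤ R} with hbox
  set f : (SliceIdx N p → ℝ) → ℝ := fun y => ‖ψ (sliceMap p (t, y))‖ with hf
  set g : (SliceIdx N p → ℝ) → ℝ := fun y => ‖fderiv ℝ ψ (sliceMap p (t, y)) e‖ with hg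
  have hsm : Measurable fun y : SliceIdx N p → ℝ => sliceMap p (t, y) :=
    (measurePreserving_sliceMap p).measurable.comp (measurable_const.prodMk measurable_id)
  have hfmeas : Measurable f := hψ.continuous.norm.measurable.comp hsm
  have hgmeas : Measurable g := (hdcont.clm_apply continuous_const).norm.measurable.comp hsm
  have hf0 : ∀ y, 0 ≤ f y := fun y => norm_nonneg _
  have hg0 : ∀ y, 0 ≤ g y := fun y => norm_nonneg _
  have hfz : ∀ y, y ∉ box → f y = 0 := fun y hy => by
    simp [hf, eq_zero_of_not_mem_sliceBox hR p t hy]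
  have hgz : ∀ y, y ∉ box → g y = 0 := fun y hy => by
    simp [hg, fderiv_eq_zero_of_not_mem_sliceBox hR p t hy]
  have hfb : ∀ y, f y ≤ C₀ := fun y => hψb _
  have hgb : ∀ y, g y ≤ C₁ * ‖e‖ := fun y =>
    (ContinuousLinearMap.le_opNorm _ _).trans (by gcongr; exact hdb _)
  -- integrability of `f²`, `g²`, `fg`
  have hind : ∀ {h : (SliceIdx N p → ℝ) → ℝ} (C : ℝ), (∀ y, 0 ≤ h y) → (∀ y, h y ≤ C) →
      (∀ y, y ∉ box → h y = 0) → ∀ y, ‖h y‖ ≤ box.indicator (fun _ => C) y := by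
    intro h C h0 hC hz y
    by_cases hy : y ∈ box
    · rw [Set.indicator_of_mem hy, Real.norm_eq_abs, abs_of_nonneg (h0 y)]; exact hC y
    · rw [Set.indicator_of_notMem hy, hz y hy, norm_zero]
  have hf2 : Integrable fun y => f y ^ 2 :=
    integrable_of_le_indicator_sliceBox p R (C₀ ^ 2) (hfmeas.pow_const 2)
      (hind (C₀ ^ 2) (fun y => sq_nonneg _) (fun y => pow_le_pow_left₀ (hf0 y) (hfb y) 2)
        (fun y hy => by simp [hfz y hy]))
  have hg2 : Integrable fun y => g y ^ 2 :=
    integrable_of_le_indicator_sliceBox p R ((C₁ * ‖e‖) ^ 2) (hgmeas.pow_const 2)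
      (hind ((C₁ * ‖e‖) ^ 2) (fun y => sq_nonneg _) (fun y => pow_le_pow_left₀ (hg0 y) (hgb y) 2)
        (fun y hy => by simp [hgz y hy]))
  have hC₀0 : 0 ≤ C₀ := (norm_nonneg _).trans (hψb 0)
  have hfg : Integrable fun y => f y * g y :=
    integrable_of_le_indicator_sliceBox p R (C₀ * (C₁ * ‖e‖)) (hfmeas.mul hgmeas)
      (hind (C₀ * (C₁ * ‖e‖)) (fun y => mul_nonneg (hf0 y) (hg0 y))
        (fun y => mul_le_mul (hfb y) (hgb y) (hg0 y) hC₀0) (fun y hy => by simp [hfz y hy]))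
  -- `|j| ≤ ∫ f g`
  have h1 : |sliceCurrent ψ p t| ≤ ∫ y, f y * g y := by
    rw [sliceCurrent]
    refine (abs_integral_le_integral_abs).trans (integral_mono_of_nonneg
      (Filter.Eventually.of_forall fun y => abs_nonneg _) hfg (Filter.Eventually.of_forall fun y => ?_))
    simp only [hf, hg]
    calc |RCLike.re (starRingEnd ℂ (ψ (sliceMap p (t, y))) * fderiv ℝ ψ (sliceMap p (t, y)) e)|
        ≤ ‖starRingEnd ℂ (ψ (sliceMap p (t, y))) * fderiv ℝ ψ (sliceMap p (t, y)) e‖ :=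
          RCLike.abs_re_le_norm _
      _ = _ := by rw [norm_mul, Complex.norm_conj]
  have h2 := integral_mul_sq_le_integral_sq_mul hf0 hg0 hf2 hg2 hfg
  have h3 : sliceCurrent ψ p t ^ 2 ≤ (∫ y, f y * g y) ^ 2 := by
    rw [← sq_abs]
    exact pow_le_pow_left₀ (abs_nonneg _) h1 2
  have hm : marginalMassReal ψ p t = ∫ y, f y ^ 2 := rfl
  have hn : normalSliceEnergyReal ψ p t = ∫ y, g y ^ 2 := rfl
  rw [hm, hn]
  exact h3.trans h2

end CauchySchwarz
end Literature.MathematicalPhysics.QuantumManyBody.BoseGas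

end
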